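import Literature.MathematicalPhysics.QuantumLattice.ProjectedEntangledPairStates
import Literature.MathematicalPhysics.QuantumLattice.ProjectedBCSState
import Literature.MathematicalPhysics.QuantumLattice.FermionRelabelling
import HarnessLib

/-!
# Fermionic projected entangled pair states (fPEPS) on the square torus

Topic `MathematicalPhysics/QuantumLattice`; definition request `defn-fermionicPEPS` (route
HubbardSuperconductivity/RvbParentAnchor, items `RvbParentGroundSpace`, `AnchorExists`: the doped
`d`-wave RVB state as a fermionic tensor network). The `ℤ₂`-graded companion of
`ProjectedEntangledPairStates.lean` (bosonic `pepsTorus`, `pepsRect`, whose tensor type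
`PEPSTensor q D`, leg order `A k l u r d` and bond conventions are REUSED) with values in the
Jordan–Wigner Fock space `Fock (Orb (FermionTorus 2 L))` of `HubbardWave0` / `HubbardModel`.

## The mathematics being formalised

Kraus–Schuch–Verstraete–Cirac (2010) §III define an fPEPS by attaching to every site four auxiliary
fermionic modes, preparing every bond in the maximally entangled state `(1 + β†_x α†_{x+e₀})|vac⟩`
of the two modes at its ends, and applying at every site a parity-preserving map
`Q_x = Σ A^{[k]}_{lrud} a†^k α^l β^r γ^u δ^d` ("`(u+d+l+r+k) mod 2 = c` fixed"):
`|Ψ⟩ = ⟨Π_x Q_x Π_x H_x V_x⟩_aux |vac⟩`. The virtual space of a leg is then the Fock space of the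
bond modes, `ℤ₂`-graded by their parity. The basis-free form of this construction — virtual legs
arbitrary finite-dimensional SUPER VECTOR SPACES `V = V⁰ ⊕ V¹` (`dim = D_e + D_o = D`), local
tensors EVEN elements of graded tensor products of `V`'s, `V*`'s and the physical space, the state
obtained by the contraction `𝒞` after the canonical reordering isomorphism
`ℱ : |i⟩ ⊗_g |j⟩ ↦ (-1)^{|i||j|} |j⟩ ⊗_g |i⟩` (Koszul sign rule) — is the fermionic tensor-network
formalism of Bultinck–Williamson–Haegeman–Verstraete (2017) §III–IV.A (fMPS) and (2018) §2, §4.1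
(fPEPS); for even tensors the result does not depend on the order in which the site tensors are
juxtaposed (2017 §IV.A). It is the formalism in which the fermionic RVB / RVB-superconductor
tensors of Poilblanc–Corboz–Schuch–Cirac (2014) are written (virtual space `½ ⊕ 0`, `D = 3`:
indices `0, 1` odd, `2` even; "fermionic character assigned to virtual and physical spins ½
following Corboz–Orús–Bauer–Vidal (2010)"). This file implements that contraction LITERALLY for one
translation-repeated tensor on the `L × L` torus, in coordinates:

* `gr : Fin D → ZMod 2` is the grading of the virtual basis, `siteGrade : Fin 4 → ZMod 2` that of
  the local basis `|0⟩, |↑⟩, |↓⟩, |↑↓⟩` of a Hubbard site (`siteOcc`, `siteCharge`);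
* the site tensor is read as the graded tensor
  `A_x = Σ A k l u r d · |l)_x ⊗ |u)_x ⊗ |k⟩_x ⊗ (r|_x ⊗ (d|_x` — KETS on the incoming (left, up)
  legs, BRAS on the outgoing (right, down) legs, internal order `l u k r d`
  (Bultinck et al. (2017) §IV.B: `A = Σ A^i_{αβ} |α) ⊗_g |i⟩ ⊗_g (β|`); evenness is
  `IsEvenFPEPSTensor`;
* the network is `𝒞(A_{x₁} ⊗_g A_{x₂} ⊗_g ⋯ ⊗_g A_{x_{L²}})`, sites in the `Lex` order of
  `FermionTorus 2 L`, contracting `(r|_x` with `|l)_{x+e₀}` and `(d|_x` with `|u)_{x+e₁}` on EVERY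
  bond including the ones that wrap around the torus (as KSVC2010 do: "this holds even for the
  bonds across the boundary");
* expanding multilinearly, a term is indexed by physical indices `k` and bond variables `η`
  (horizontal), `ν` (vertical); its coefficient is the bosonic weight `fpepsWeight = Π_x A^{k_x}_{…}`
  (literally the summand of `pepsTorus`) times `fpepsSign`, the KOSZUL SIGN of the permutation that
  reorders the word `⊗_x (l_x u_x k_x r_x d_x)` so that every bra stands immediately left of the ket
  it is contracted with (then `𝒞((i| ⊗ |j)) = δ_{ij}` costs no sign) and the physical kets stand in
  increasing site order; `koszulSign`/`gradedInversions` compute it as `(-1)^{#odd–odd inversions}`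
  between the source arrangement and the target arrangement `legTarget` (positions of the even,
  already adjacent pairs are immaterial);
* the remaining word `|k_{x₁}⟩ ⊗_g ⋯ ⊗_g |k_{x_{L²}}⟩` is the Fock basis vector
  `Π^{<}_{(x,σ) ∈ s} c†_{(x,σ)} |vac⟩ = |s⟩` of the tree (`annihilation`/`jwSign`: creation operators in
  increasing `Orb` order, which is site-major with `↑ < ↓`), `s ↔ k` via `siteConfig`/`siteOcc` —
  the identification of KSVC2010 §IV ("associate `a†^{k₁}_1 ⋯ a†^{k_N}_N |vac⟩` to `|k₁,…,k_N⟩`",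
  sites sorted) and of Bultinck et al. (2017) §III (`ℱ` "shows why even (odd) vectors can be
  interpreted as having even (odd) fermion number").

Consistency remark (hand computation, not a theorem of this file): for `L = 1` (one site, both
bonds self-contracted) the recipe gives the coefficient `Σ_{α,β} (-1)^{|α| + |β| + |α||β|} A^k_{αβαβ}`
of `|k⟩` — one supertrace sign `(-1)^{|α|}` per closed loop (`𝒞(|α) ⊗ (α|) = (-1)^{|α|}`,
Bultinck et al. (2017) §III, the parity matrix `P` of their periodic even fMPS, §IV.B)
and `(-1)^{|α||β|}` from the interleaving `l u r d` of the two loops in the internal order; the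
`1 × 1`, `2 × 1` and `1 × 2` block signs were machine-checked (`decide`) on examples kept in the
session folder.

## Contents

* `gradedInversions`, `koszulSign` (+ `_mul_self`, `_of_even`, `_of_strictMono`): Koszul signs
  of reorderings of graded words, for any two arrangements of a finite letter type.
* `siteOcc`, `siteIndex`, `siteEquiv : Fin 4 ≃ Finset (Fin 2)`, `siteCharge`, `siteGrade`,
  `localOcc`, `siteConfig`, `card_eq_sum_siteCharge` (`#s = Σ_x |k_x|_N`).
* `backStep i : FermionTorus 2 L ≃ FermionTorus 2 L` (`x ↦ x - e_i`), `FPEPSLeg`, `legTarget`,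
  `legDegree`, `fpepsSign`, `fpepsWeight`, `fpepsAmplitude`, **`fermionicPEPS L gr A`**,
  `IsEvenFPEPSTensor gr A`.
* Proved API: `fermionicPEPS_apply`; PARITY SUPERSELECTION
  `fermionicPEPS_apply_eq_zero_of_odd` (even tensor ⇒ no odd-`N` components; KSVC2010 §III "the
  parity of the fPEPS is well defined", Bultinck et al. (2017) §IV.B) and
  `numberProj_mulVec_fermionicPEPS_of_odd`; NUMBER PROJECTIONS
  `numberProj_mulVec_fermionicPEPS_mem` (`P_N |Ψ⟩ ∈ nParticleSubmodule N`, with `numberProj` of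
  `ProjectedBCSState`) and the number tower `sum_numberProj_mulVec`; homogeneity
  `fermionicPEPS_smul`; `physTwist` and `fermionicPEPS_physTwist` /
  `chargeTwist_mulVec_fermionicPEPS` (`z^{N̂} |Ψ(A)⟩ = |Ψ(z^{|k|} A)⟩`: the charge rotation acts
  through the physical leg); diagonal virtual gauges `legGauge` and the gauge invariance
  `fermionicPEPS_legGauge`; the `U(1)`-COVARIANCE LEMMA
  `chargeTwist_mulVec_fermionicPEPS_of_covariant` (if `z^{|k|} A = w · (g ⊗ h ⊗ g⁻¹ ⊗ h⁻¹) A` then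
  `z^{N̂}|Ψ⟩ = w^{L²}|Ψ⟩`) and `isNParticle_fermionicPEPS_of_covariant` (then `|Ψ⟩` has
  `c L²` electrons when `w = z^c`); `fermionicPEPS_eq_zero_of_D_eq_zero`.
* Blocks with open legs (`n` columns `×` `m` rows, bond variables as in `pepsRectWeight`):
  `FPEPSBlockLeg`, `blockLegTarget` (internal order of the blocked tensor:
  open kets `|l_b)`, `|u_a)`, physical kets, open bras `(r_b|`, `(d_a|`), `blockLegDegree`,
  `fpepsRectSign`, the FERMIONIC BLOCK MAP `fpepsRect n m gr A : PEPSBoundary D n m → Fock (Orb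
  (Fin n ×ₗ Fin m))` and its linear-map packaging `fpepsRectLin`, `boundaryGrade`, the even
  boundary subspace `evenBoundary`, `fpepsRectRange` (`𝒮_{n×m}`), `IsInjectiveFPEPS`,
  `IsParityInjectiveFPEPS` (injective on the even boundary subspace = `G`-injectivity for the
  fermion-parity `ℤ₂`), `IsInjectiveFPEPS.isParityInjective`, and `fpepsRect_one_one` (a single
  site needs no reordering: the fermionic and bosonic one-site maps agree).

## Conventions (all choices are documented here; cf. Bultinck et al. (2018) §2, §4.1)

Geometry as in `ProjectedEntangledPairStates`: coordinate `0` horizontal, `1` vertical,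
`e_i = torusUnit L i`, `η x` on the bond `x — x+e₀` (right leg of `x`, left leg of `x+e₀`), `ν x`
on `x — x+e₁`; sites of `FermionTorus 2 L = Lex (Fin 2 → Fin L)` are compared lexicographically
(coordinate `0` major), translations go through `FermionTorus.ofTorusEquiv`. Internal order
`l u k r d`, arrows: kets on left/up legs, bras on right/down legs, uniformly on all bonds. Any
other internal order or arrow pattern is obtained by absorbing signs `(-1)^{|i||j|}` into the
tensor entries and/or inserting parity matrices `P = (-1)^{|a|} δ_{ab}` on the affected legs
(Bultinck et al. (2018) §2 last paragraph and §4.1: "reversing the arrow on a link is equivalent to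
inserting a parity matrix … reminiscent of a lattice spin structure"); in particular the uniform
arrow pattern fixes ONE closure (spin structure) in each torus direction, the others being
`fermionicPEPS` of leg-twisted tensors along a seam (not defined here, cf. `pepsTorusTwisted`).
The grading `gr` is a free `ℤ₂`-valued function (no even-before-odd normal form is imposed).
Blocks `Fin n ×ₗ Fin m` carry the lexicographic order, which is the order the torus induces on a
block that does not wrap around the seam `L-1 | 0`; transporting a block state to a wrapped
position needs the orbital relabelling unitary (`fockMapOp`), which is where the parent Hamiltonian
construction (a separate request) must handle reordering signs.

## Degenerate values (documented junk)

`D = 0`: no bond variables, `fermionicPEPS L gr A = 0` (`fermionicPEPS_eq_zero_of_D_eq_zero`),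
every block map is injective. `L = 0` is excluded by `[NeZero L]`. Tensors that are not even are
allowed by the definition (the formula makes sense) but only even tensors give an
order-independent network; all literature statements assume `IsEvenFPEPSTensor`.

## What is NOT here (and why)

* No fermionic parent Hamiltonian / ground-space theorem (definition request (2) of the route;
  KSVC2010 §V prove a parent-Hamiltonian statement only for Gaussian fPEPS, and the injective
  `ℤ₂`-graded analogue of Schuch–Cirac–Pérez-García (2010) Thm. 5.7 is to be PROVED, see the
  module docstring of `ProjectedEntangledPairStates`).
* No seam-twisted closures (the other three spin structures), no non-diagonal virtual gauge
  invariance (`legAct`), no `SU(2)` covariance beyond its Cartan part (diagonal `h`, `S^z`), no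
  blocking isomorphism `(block of A) ↦ one tensor`, no swap-gate (Corboz–Orús–Bauer–Vidal 2010) or
  Grassmann-variable (Gu–Verstraete–Wen) reformulation, no explicit RVB tensor (route work).

## Mathlib / tree search

Mathlib has super-algebra gradings (`GradedAlgebra`, `CliffordAlgebra.evenOdd`) but no super
vector-space tensor calculus, Koszul sign of a permutation, fermionic tensor network or PEPS
(`lean search 'koszul|Koszul'`: only cohomological sign lemmas under
`Literature.AlgebraicGeometry.Motives`, unrelated types). Reused from the tree: `PEPSTensor`,
`PEPSBoundary`, `pepsRectWeight`, `pepsRect`, `torusUnit` (`ProjectedEntangledPairStates`), `Fock`,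
`Orb`, `orb`, `IsNParticle` (`HubbardWave0`), `nParticleSubmodule` (`FermionOperators`),
`FermionTorus`, `FermionTorus.ofTorusSite` (`HubbardModel`), `FermionTorus.ofTorusEquiv`
(`FermionRelabelling`), `numberProj`, `numberProj_mulVec_apply`, `isNParticle_numberProj_mulVec`
(`ProjectedBCSState`).

## References

* C. V. Kraus, N. Schuch, F. Verstraete, J. I. Cirac, *Fermionic projected entangled pair states*,
  Phys. Rev. A **81** (2010) 052338, arXiv:0904.4667: §III (definition: auxiliary modes,
  bonds `H`, `V`, maps `Q`, the formula for `|Ψ⟩`), §IV (Fock identification, sign bookkeeping).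
  [KrausSchuchVerstraeteCirac2010]
* N. Bultinck, D. J. Williamson, J. Haegeman, F. Verstraete, *Fermionic matrix product states and
  one-dimensional topological phases*, Phys. Rev. B **95** (2017) 075108, arXiv:1610.07849: §III
  (super vector spaces, `ℱ`, `𝒞`, supertrace), §IV.A (fermionic tensor networks, even tensors,
  contraction recipe), §IV.B (even-parity fMPS, parity matrix `P`), §V (parent Hamiltonian,
  injectivity / left inverse, stability under blocking). [BultinckWilliamsonHaegemanVerstraete2017fMPS]
* N. Bultinck, D. J. Williamson, J. Haegeman, F. Verstraete, *Fermionic projected entangled-pair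
  states and topological phases*, J. Phys. A **51** (2018) 025202, arXiv:1707.00470: §2
  (contraction rules, internal ordering), §4.1 (arrows and spin structures).
  [BultinckWilliamsonHaegemanVerstraete2018fPEPS]
* D. Poilblanc, P. Corboz, N. Schuch, J. I. Cirac, *Resonating-valence-bond superconductors with
  fermionic projected entangled pair states*, Phys. Rev. B **89** (2014) 241106(R),
  arXiv:1404.5268, pp. 2–3 (`D = 3`, virtual `½ ⊕ 0`, fermionic signs à la Corboz et al.).
  [PoilblancCorbozSchuchCirac2014]
* P. Corboz, R. Orús, B. Bauer, G. Vidal, Phys. Rev. B **81** (2010) 165104 (parity-preserving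
  tensors). [CorbozOrusBauerVidal2010]
* N. Schuch, I. Cirac, D. Pérez-García, Ann. Phys. **325** (2010) 2153, Def. 2.2, Def. 5.1
  (PEPS, gauges, `G`-injectivity); D. Pérez-García, F. Verstraete, M. M. Wolf, J. I. Cirac,
  Quantum Inf. Comput. **8** (2008) 650, §4 (`Γ_R`). [SchuchCiracPerezGarcia2010]
  [PerezGarciaVerstraeteWolfCirac2008PEPS]
-/

noncomputable section

open Matrix Complex Finset
open scoped ComplexOrder

namespace Literature.MathematicalPhysics.QuantumLattice

open Literature.Probability.LatticeModels

/-! ### Koszul signs of reorderings of graded words -/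

section Koszul

variable {ι α β : Type*} [Fintype ι] [LinearOrder α] [LinearOrder β]

/-- The number of **graded inversions** between two arrangements `f`, `g` of a finite set of
letters `ι` carrying `ℤ₂`-degrees `deg`: pairs of ODD letters `(a, b)` with `f a < f b` but
`g b < g a`. [folklore] -/
def gradedInversions (deg : ι → ZMod 2) (f : ι → α) (g : ι → β) : ℕ :=
  (univ.filter fun p : ι × ι => f p.1 < f p.2 ∧ g p.2 < g p.1 ∧ deg p.1 = 1 ∧ deg p.2 = 1).card

/-- The **Koszul sign** `(-1)^{#graded inversions}` of the permutation carrying the word of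
homogeneous letters `ι` from the arrangement `f` to the arrangement `g`: the sign produced by
the canonical reordering isomorphism `ℱ : |i⟩ ⊗_g |j⟩ ↦ (-1)^{|i||j|} |j⟩ ⊗_g |i⟩` of super vector
spaces applied transposition by transposition (Bultinck–Williamson–Haegeman–Verstraete 2017 §III,
the map `ℱ`). [cite: BultinckWilliamsonHaegemanVerstraete2017fMPS, §III] -/
def koszulSign (deg : ι → ZMod 2) (f : ι → α) (g : ι → β) : ℂ :=
  (-1) ^ gradedInversions deg f g

/-- A Koszul sign squares to one. [folklore] -/
theorem koszulSign_mul_self (deg : ι → ZMod 2) (f : ι → α) (g : ι → β) :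
    koszulSign deg f g * koszulSign deg f g = 1 := by
  rw [koszulSign, ← pow_add, ← two_mul, pow_mul, neg_one_sq, one_pow]

/-- Without odd letters there are no graded inversions. [folklore] -/
theorem gradedInversions_eq_zero_of_even {deg : ι → ZMod 2} (h : ∀ i, deg i = 0) (f : ι → α)
    (g : ι → β) : gradedInversions deg f g = 0 := by
  rw [gradedInversions, Finset.card_eq_zero, Finset.filter_eq_empty_iff]
  intro p _ hp
  have h1 := hp.2.2.1
  rw [h] at h1
  exact zero_ne_one h1

/-- Purely even words reorder without sign (the bosonic case). [folklore] -/
theorem koszulSign_of_even {deg : ι → ZMod 2} (h : ∀ i, deg i = 0) (f : ι → α) (g : ι → β) :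
    koszulSign deg f g = 1 := by
  rw [koszulSign, gradedInversions_eq_zero_of_even h, pow_zero]

/-- Order-preserving rearrangements have no graded inversions. [folklore] -/
theorem gradedInversions_eq_zero_of_strictMono {deg : ι → ZMod 2} {f : ι → α} {g : ι → β}
    (h : ∀ i j, f i < f j → g i < g j) : gradedInversions deg f g = 0 := by
  rw [gradedInversions, Finset.card_eq_zero, Finset.filter_eq_empty_iff]
  intro p _ hp
  exact lt_asymm (h _ _ hp.1) hp.2.1

/-- Order-preserving rearrangements have Koszul sign `1`. [folklore] -/
theorem koszulSign_of_strictMono {deg : ι → ZMod 2} {f : ι → α} {g : ι → β}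
    (h : ∀ i j, f i < f j → g i < g j) : koszulSign deg f g = 1 := by
  rw [koszulSign, gradedInversions_eq_zero_of_strictMono h, pow_zero]

end Koszul

/-! ### The local Hilbert space of a Hubbard site as a super vector space -/

section Site

/-- The occupation pattern of the local basis state `k : Fin 4` of a Hubbard site:
`0 ↦ ∅` (empty), `1 ↦ {↑}`, `2 ↦ {↓}`, `3 ↦ {↑, ↓}` (spin `0 = ↑`, `1 = ↓` as in `Orb`), i.e.
`|k⟩ = (c†_↑)^{[↑ ∈ k]} (c†_↓)^{[↓ ∈ k]} |0⟩`. [folklore] -/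
def siteOcc : Fin 4 → Finset (Fin 2) := ![∅, {0}, {1}, univ]

/-- The local basis index of an occupation pattern (inverse of `siteOcc`). [folklore] -/
def siteIndex (t : Finset (Fin 2)) : Fin 4 :=
  if (0 : Fin 2) ∈ t then (if (1 : Fin 2) ∈ t then 3 else 1) else (if (1 : Fin 2) ∈ t then 2 else 0)

/-- `siteIndex ∘ siteOcc = id`. [folklore] -/
@[simp] theorem siteIndex_siteOcc (k : Fin 4) : siteIndex (siteOcc k) = k := by
  fin_cases k <;> decide

/-- `siteOcc ∘ siteIndex = id`. [folklore] -/
@[simp] theorem siteOcc_siteIndex (t : Finset (Fin 2)) : siteOcc (siteIndex t) = t := by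
  have ht : t = ∅ ∨ t = {0} ∨ t = {1} ∨ t = univ := by
    fin_cases t <;> decide
  rcases ht with rfl | rfl | rfl | rfl <;> decide

/-- The local basis `Fin 4 ≃ 𝒫{↑,↓}` of a Hubbard site. [folklore] -/
def siteEquiv : Fin 4 ≃ Finset (Fin 2) :=
  ⟨siteOcc, siteIndex, siteIndex_siteOcc, siteOcc_siteIndex⟩

/-- The electron number `|k|_N ∈ {0, 1, 1, 2}` of the local basis state `k`. [folklore] -/
def siteCharge (k : Fin 4) : ℕ := (siteOcc k).card

/-- The fermion parity `|k| ∈ ℤ₂` of the local basis state `k` (the `ℤ₂`-grading of the local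
Hilbert space `ℂ⁴ = ℂ² ⊕ ℂ²`: `|0⟩, |↑↓⟩` even, `|↑⟩, |↓⟩` odd).
[cite: BultinckWilliamsonHaegemanVerstraete2017fMPS, §III] -/
def siteGrade (k : Fin 4) : ZMod 2 := (siteCharge k : ZMod 2)

/-- `|0⟩` is empty. [folklore] -/
@[simp] theorem siteOcc_zero : siteOcc 0 = ∅ := rfl
/-- `|1⟩ = |↑⟩`. [folklore] -/
@[simp] theorem siteOcc_one : siteOcc 1 = {0} := rfl
/-- `|2⟩ = |↓⟩`. [folklore] -/
@[simp] theorem siteOcc_two : siteOcc 2 = {1} := rfl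
/-- `|3⟩ = |↑↓⟩`. [folklore] -/
@[simp] theorem siteOcc_three : siteOcc 3 = univ := rfl
/-- Charges of the four local states: `0, 1, 1, 2`. [folklore] -/
@[simp] theorem siteCharge_zero : siteCharge 0 = 0 := by decide
/-- Charges of the four local states: `0, 1, 1, 2`. [folklore] -/
@[simp] theorem siteCharge_one : siteCharge 1 = 1 := by decide
/-- Charges of the four local states: `0, 1, 1, 2`. [folklore] -/
@[simp] theorem siteCharge_two : siteCharge 2 = 1 := by decide
/-- Charges of the four local states: `0, 1, 1, 2`. [folklore] -/
@[simp] theorem siteCharge_three : siteCharge 3 = 2 := by decide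
/-- Parities of the four local states: even, odd, odd, even. [folklore] -/
@[simp] theorem siteGrade_zero : siteGrade 0 = 0 := by decide
/-- Parities of the four local states: even, odd, odd, even. [folklore] -/
@[simp] theorem siteGrade_one : siteGrade 1 = 1 := by decide
/-- Parities of the four local states: even, odd, odd, even. [folklore] -/
@[simp] theorem siteGrade_two : siteGrade 2 = 1 := by decide
/-- Parities of the four local states: even, odd, odd, even. [folklore] -/
@[simp] theorem siteGrade_three : siteGrade 3 = 0 := by decide

variable {Λ : Type*} [LinearOrder Λ]

/-- The local occupation pattern `{σ | (x, σ) ∈ s}` of the site `x` in the configuration `s`.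
[folklore] -/
def localOcc (s : Finset (Orb Λ)) (x : Λ) : Finset (Fin 2) := univ.filter fun σ => orb x σ ∈ s

/-- The local basis index of the site `x` in the configuration `s`. [folklore] -/
def siteConfig (s : Finset (Orb Λ)) (x : Λ) : Fin 4 := siteIndex (localOcc s x)

/-- `siteOcc (siteConfig s x)` is the local occupation pattern. [folklore] -/
@[simp] theorem siteOcc_siteConfig (s : Finset (Orb Λ)) (x : Λ) :
    siteOcc (siteConfig s x) = localOcc s x :=
  siteOcc_siteIndex _

/-- Every site of the empty configuration is empty. [folklore] -/
@[simp] theorem localOcc_empty (x : Λ) : localOcc (∅ : Finset (Orb Λ)) x = ∅ := by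
  simp [localOcc]

/-- Every site of the empty configuration is in the local state `|0⟩`. [folklore] -/
@[simp] theorem siteConfig_empty (x : Λ) : siteConfig (∅ : Finset (Orb Λ)) x = 0 := by
  simp [siteConfig, siteIndex]

/-- Every site of the full configuration is doubly occupied. [folklore] -/
@[simp] theorem localOcc_univ [Fintype Λ] (x : Λ) : localOcc (univ : Finset (Orb Λ)) x = univ := by
  simp [localOcc]

/-- Every site of the full configuration is in the local state `|↑↓⟩`. [folklore] -/
@[simp] theorem siteConfig_univ [Fintype Λ] (x : Λ) : siteConfig (univ : Finset (Orb Λ)) x = 3 := by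
  simp [siteConfig, siteIndex]

/-- The electron number of a configuration is the sum of the local electron numbers.
[folklore] -/
theorem card_eq_sum_card_localOcc [Fintype Λ] (s : Finset (Orb Λ)) :
    s.card = ∑ x, (localOcc s x).card := by
  classical
  rw [Finset.card_eq_sum_card_fiberwise (f := fun i : Orb Λ => (ofLex i).1) (t := univ)
    fun _ _ => Finset.mem_coe.mpr (mem_univ _)]
  refine Finset.sum_congr rfl fun x _ => ?_
  have hmap : (s.filter fun i : Orb Λ => (ofLex i).1 = x) =
      (localOcc s x).map ⟨fun σ => orb x σ, fun σ τ h => by simpa using congrArg (fun i => (ofLex i).2) h⟩ := by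
    ext i
    simp only [mem_filter, mem_map, localOcc, mem_univ, true_and, Function.Embedding.coeFn_mk]
    constructor
    · rintro ⟨hi, rfl⟩
      have hi' : orb (ofLex i).1 (ofLex i).2 = i := by simp only [orb, Prod.mk.eta, toLex_ofLex]
      exact ⟨(ofLex i).2, by rw [hi']; exact hi, hi'⟩
    · rintro ⟨σ, hσ, rfl⟩
      exact ⟨hσ, rfl⟩
  rw [hmap, card_map]

/-- The electron number of a configuration is the sum of the local charges `|k_x|_N`.
[folklore] -/
theorem card_eq_sum_siteCharge [Fintype Λ] (s : Finset (Orb Λ)) :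
    s.card = ∑ x, siteCharge (siteConfig s x) := by
  simp only [siteCharge, siteOcc_siteConfig, card_eq_sum_card_localOcc]

end Site

/-! ### The fermionic PEPS on the torus -/

section Torus

variable {L : ℕ} [NeZero L] {D : ℕ}

/-- The translation `x ↦ x - e_i` of the fermionic torus (`e_i = torusUnit L i`, through
`FermionTorus.ofTorusEquiv`), a bijection. [folklore] -/
def backStep (i : Fin 2) : FermionTorus 2 L ≃ FermionTorus 2 L :=
  FermionTorus.ofTorusEquiv (Equiv.subRight (torusUnit L i))

/-- The letters of the graded word of the torus network: `(x, slot)` with `slot = 0,1,2,3,4` for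
the left ket, up ket, physical ket, right bra, down bra of the site tensor at `x`; the SOURCE
arrangement is the lexicographic order (sites in the `Lex` order of `FermionTorus 2 L`, and inside
a site the internal order `|l) |u) |k⟩ (r| (d|`). [folklore] -/
abbrev FPEPSLeg (L : ℕ) : Type := FermionTorus 2 L ×ₗ Fin 5

/-- The TARGET arrangement of the letters, in which every contracted pair is adjacent with the
bra first — `(r|_x |l)_{x+e₀}` and `(d|_x |u)_{x+e₁}`, pairs listed bond by bond — followed by the
physical kets in increasing site order. Encoded as a ranking in
`Fin 2 ×ₗ (FermionTorus 2 L ×ₗ Fin 4)`: bond letters `(0, source site of the bond, 0…3)`,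
physical letters `(1, x, 0)`. [cite: BultinckWilliamsonHaegemanVerstraete2017fMPS, §IV.A] -/
def legTarget (a : FPEPSLeg L) : Fin 2 ×ₗ (FermionTorus 2 L ×ₗ Fin 4) :=
  ![(toLex ((0 : Fin 2), toLex (backStep 0 (ofLex a).1, (1 : Fin 4))) :
      Fin 2 ×ₗ (FermionTorus 2 L ×ₗ Fin 4)),
    toLex ((0 : Fin 2), toLex (backStep 1 (ofLex a).1, (3 : Fin 4))),
    toLex ((1 : Fin 2), toLex ((ofLex a).1, (0 : Fin 4))),
    toLex ((0 : Fin 2), toLex ((ofLex a).1, (0 : Fin 4))),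
    toLex ((0 : Fin 2), toLex ((ofLex a).1, (2 : Fin 4)))] (ofLex a).2

/-- The `ℤ₂`-degrees of the letters for given physical indices `k`, horizontal bond variables
`η` (`η x` on the bond `x — x+e₀`) and vertical ones `ν` (`ν x` on `x — x+e₁`), virtual grading
`gr`: the left leg of `x` carries `η (x - e₀)`, the up leg `ν (x - e₁)`, the right leg `η x`,
the down leg `ν x`. [cite: BultinckWilliamsonHaegemanVerstraete2017fMPS, §IV.A] -/
def legDegree (gr : Fin D → ZMod 2) (k : FermionTorus 2 L → Fin 4)
    (η ν : FermionTorus 2 L → Fin D) (a : FPEPSLeg L) : ZMod 2 :=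
  ![gr (η (backStep 0 (ofLex a).1)), gr (ν (backStep 1 (ofLex a).1)), siteGrade (k (ofLex a).1),
    gr (η (ofLex a).1), gr (ν (ofLex a).1)] (ofLex a).2

/-- **The sign of one term of the fermionic contraction**: the Koszul sign of the reordering of
the graded word `⊗_x (|l)_x |u)_x |k_x⟩ (r|_x (d|_x)` (sites in increasing order) that brings every
bra next to (and left of) the ket it is contracted with, keeping the physical kets in increasing
site order. [cite: BultinckWilliamsonHaegemanVerstraete2017fMPS, §IV.A] -/
def fpepsSign (gr : Fin D → ZMod 2) (k : FermionTorus 2 L → Fin 4)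
    (η ν : FermionTorus 2 L → Fin D) : ℂ :=
  koszulSign (legDegree gr k η ν) (fun a : FPEPSLeg L => a) legTarget

/-- The (bosonic) weight of one assignment of the bond variables:
`Π_x A^{k_x}_{η(x-e₀) ν(x-e₁) η(x) ν(x)}`, exactly as in `pepsTorus`. [cite: SchuchCiracPerezGarcia2010, Def. 2.2] -/
def fpepsWeight (A : PEPSTensor 4 D) (k : FermionTorus 2 L → Fin 4)
    (η ν : FermionTorus 2 L → Fin D) : ℂ :=
  ∏ x, A (k x) (η (backStep 0 x)) (ν (backStep 1 x)) (η x) (ν x)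

/-- The amplitude of the physical basis word `⊗_x |k_x⟩`: the signed sum over all bond
variables `Σ_{η ν} sign · Π_x A^{k_x}_{…}`. [cite: KrausSchuchVerstraeteCirac2010, §III] -/
def fpepsAmplitude (gr : Fin D → ZMod 2) (A : PEPSTensor 4 D) (k : FermionTorus 2 L → Fin 4) : ℂ :=
  ∑ η : FermionTorus 2 L → Fin D, ∑ ν : FermionTorus 2 L → Fin D,
    fpepsSign gr k η ν * fpepsWeight A k η ν

/-- **The fermionic PEPS** `|Ψ(A)⟩ ∈ Fock (Orb (FermionTorus 2 L))` of ONE local tensor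
`A : PEPSTensor 4 D` (physical index `k : Fin 4` = empty/↑/↓/↑↓, virtual legs left, up, right,
down in `Fin D` with `ℤ₂`-grading `gr`) repeated over the `L × L` torus: the coefficient of the
occupation basis vector `|s⟩` is the fermionic contraction amplitude of the word `⊗_x |k_x⟩`,
`k_x = siteConfig s x`. [cite: KrausSchuchVerstraeteCirac2010, §III] -/
def fermionicPEPS (L : ℕ) [NeZero L] (gr : Fin D → ZMod 2) (A : PEPSTensor 4 D) :
    Fock (Orb (FermionTorus 2 L)) :=
  fun s => fpepsAmplitude gr A (siteConfig s)

/-- **Even (parity-preserving) tensors**: every nonzero entry `A^k_{l u r d}` has total degree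
`|k| + |l| + |u| + |r| + |d| = 0` in `ℤ₂`. Kraus–Schuch–Verstraete–Cirac (2010) §III
("`(u+d+l+r+k) mod 2 = c` … fixed for each node", here `c = 0`); Bultinck et al. (2017) §IV.A
(homogeneous even tensors). [cite: KrausSchuchVerstraeteCirac2010, §III] -/
def IsEvenFPEPSTensor (gr : Fin D → ZMod 2) (A : PEPSTensor 4 D) : Prop :=
  ∀ k l u r d, A k l u r d ≠ 0 → siteGrade k + gr l + gr u + gr r + gr d = 0

/-- `fermionicPEPS` unfolded at a configuration. [folklore] -/
theorem fermionicPEPS_apply (gr : Fin D → ZMod 2) (A : PEPSTensor 4 D)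
    (s : Finset (Orb (FermionTorus 2 L))) :
    fermionicPEPS L gr A s =
      ∑ η : FermionTorus 2 L → Fin D, ∑ ν : FermionTorus 2 L → Fin D,
        fpepsSign gr (siteConfig s) η ν * fpepsWeight A (siteConfig s) η ν := rfl

/-- The signs are `±1`. [folklore] -/
theorem fpepsSign_mul_self (gr : Fin D → ZMod 2) (k : FermionTorus 2 L → Fin 4)
    (η ν : FermionTorus 2 L → Fin D) : fpepsSign gr k η ν * fpepsSign gr k η ν = 1 :=
  koszulSign_mul_self _ _ _

/-! #### Fermion parity superselection -/

/-- For an even tensor, a bond assignment with nonzero weight has even total physical parity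
`Σ_x |k_x| = 0`: summing the evenness condition over the sites, every bond variable is counted
twice. [cite: KrausSchuchVerstraeteCirac2010, §III] -/
theorem sum_siteGrade_eq_zero_of_fpepsWeight_ne_zero {gr : Fin D → ZMod 2} {A : PEPSTensor 4 D}
    (hA : IsEvenFPEPSTensor gr A) {k : FermionTorus 2 L → Fin 4} {η ν : FermionTorus 2 L → Fin D}
    (h : fpepsWeight A k η ν ≠ 0) : ∑ x, siteGrade (k x) = 0 := by
  have hx : ∀ x, siteGrade (k x) + gr (η (backStep 0 x)) + gr (ν (backStep 1 x)) + gr (η x) +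
      gr (ν x) = 0 := fun x =>
    hA _ _ _ _ _ fun h0 => h (Finset.prod_eq_zero (mem_univ x) h0)
  have hsum : ∑ x, (siteGrade (k x) + gr (η (backStep 0 x)) + gr (ν (backStep 1 x)) + gr (η x) +
      gr (ν x)) = 0 := Finset.sum_eq_zero fun x _ => hx x
  have h0 : ∑ x, gr (η (backStep 0 x)) = ∑ x, gr (η x) :=
    Fintype.sum_equiv (backStep 0) _ _ fun _ => rfl
  have h1 : ∑ x, gr (ν (backStep 1 x)) = ∑ x, gr (ν x) :=
    Fintype.sum_equiv (backStep 1) _ _ fun _ => rfl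
  simp only [Finset.sum_add_distrib, h0, h1] at hsum
  have key : ∑ x, siteGrade (k x) + ((∑ x, gr (η x) + ∑ x, gr (ν x)) +
      (∑ x, gr (η x) + ∑ x, gr (ν x))) = 0 := by
    rw [← hsum]; abel
  rwa [CharTwo.add_self_eq_zero, add_zero] at key

/-- For an even tensor the weight of every bond assignment vanishes on configurations of odd
total physical parity. [cite: KrausSchuchVerstraeteCirac2010, §III] -/
theorem fpepsWeight_eq_zero_of_sum_siteGrade_ne_zero {gr : Fin D → ZMod 2} {A : PEPSTensor 4 D}
    (hA : IsEvenFPEPSTensor gr A) {k : FermionTorus 2 L → Fin 4}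
    (hk : ∑ x, siteGrade (k x) ≠ 0) (η ν : FermionTorus 2 L → Fin D) :
    fpepsWeight A k η ν = 0 := by
  by_contra h
  exact hk (sum_siteGrade_eq_zero_of_fpepsWeight_ne_zero hA h)

/-- **Parity superselection.** The fermionic PEPS of an even tensor has even fermion parity: its
coefficients on configurations with an odd number of electrons vanish. Kraus–Schuch–Verstraete–
Cirac (2010) §III ("will ensure that the parity of the fPEPS is well defined"); Bultinck et al.
(2017) §IV.B ("being the contraction of these even tensors, has even fermion parity").
[cite: KrausSchuchVerstraeteCirac2010, §III] -/
theorem fermionicPEPS_apply_eq_zero_of_odd {gr : Fin D → ZMod 2} {A : PEPSTensor 4 D}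
    (hA : IsEvenFPEPSTensor gr A) {s : Finset (Orb (FermionTorus 2 L))} (hs : Odd s.card) :
    fermionicPEPS L gr A s = 0 := by
  have hk : ∑ x, siteGrade (siteConfig s x) ≠ 0 := by
    have : ((s.card : ℕ) : ZMod 2) = ∑ x, siteGrade (siteConfig s x) := by
      rw [card_eq_sum_siteCharge, Nat.cast_sum]; rfl
    rw [← this]
    exact ZMod.natCast_ne_zero_iff_odd.mpr hs
  refine Finset.sum_eq_zero fun η _ => Finset.sum_eq_zero fun ν _ => ?_
  rw [fpepsWeight_eq_zero_of_sum_siteGrade_ne_zero hA hk, mul_zero]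

/-- The fermionic PEPS of an even tensor is annihilated by the projections on the odd particle
numbers. [cite: KrausSchuchVerstraeteCirac2010, §III] -/
theorem numberProj_mulVec_fermionicPEPS_of_odd [DecidableEq (Orb (FermionTorus 2 L))]
    {gr : Fin D → ZMod 2} {A : PEPSTensor 4 D} (hA : IsEvenFPEPSTensor gr A) {N : ℕ}
    (hN : Odd N) : numberProj N *ᵥ fermionicPEPS L gr A = 0 := by
  funext s
  rw [numberProj_mulVec_apply, Pi.zero_apply]
  split_ifs with h
  · exact fermionicPEPS_apply_eq_zero_of_odd hA (h ▸ hN)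
  · rfl

/-! #### Number projections -/

/-- The number projection `P_N |Ψ(A)⟩` lies in the `N`-particle sector. [folklore] -/
theorem numberProj_mulVec_fermionicPEPS_mem [DecidableEq (Orb (FermionTorus 2 L))]
    (gr : Fin D → ZMod 2) (A : PEPSTensor 4 D) (N : ℕ) :
    numberProj N *ᵥ fermionicPEPS L gr A ∈ nParticleSubmodule N :=
  isNParticle_numberProj_mulVec N _

/-- The number tower: every Fock vector is the sum of its number projections,
`ψ = Σ_{N ≤ |ι|} P_N ψ`. [folklore] -/
theorem sum_numberProj_mulVec {ι : Type*} [DecidableEq ι] [Fintype ι] (ψ : Fock ι) :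
    ∑ N ∈ range (Fintype.card ι + 1), numberProj N *ᵥ ψ = ψ := by
  funext s
  rw [Finset.sum_apply]
  simp only [numberProj_mulVec_apply]
  rw [Finset.sum_ite_eq (range (Fintype.card ι + 1)) s.card (fun _ => ψ s), if_pos]
  exact mem_range.mpr (Nat.lt_succ_of_le (Finset.card_le_univ s))

/-! #### Multilinearity, physical twists and virtual gauges -/

/-- Homogeneity: `|Ψ(c A)⟩ = c^{L²} |Ψ(A)⟩` (one factor per site). [folklore] -/
theorem fermionicPEPS_smul (gr : Fin D → ZMod 2) (c : ℂ) (A : PEPSTensor 4 D) :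
    fermionicPEPS L gr (c • A) = c ^ Fintype.card (FermionTorus 2 L) • fermionicPEPS L gr A := by
  funext s
  simp only [fermionicPEPS_apply, Pi.smul_apply, smul_eq_mul, Finset.mul_sum]
  refine Finset.sum_congr rfl fun η _ => Finset.sum_congr rfl fun ν _ => ?_
  have : fpepsWeight (c • A) (siteConfig s) η ν =
      c ^ Fintype.card (FermionTorus 2 L) * fpepsWeight A (siteConfig s) η ν := by
    simp only [fpepsWeight, Pi.smul_apply, smul_eq_mul, Finset.prod_mul_distrib,
      Finset.prod_const, Finset.card_univ]
  rw [this]; ring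

/-- A one-site diagonal operator `θ` (in the local basis) applied to the physical leg of the
tensor: `(θ · A)^k = θ_k A^k`. [folklore] -/
def physTwist (θ : Fin 4 → ℂ) (A : PEPSTensor 4 D) : PEPSTensor 4 D := fun k => θ k • A k

/-- `physTwist` entrywise. [folklore] -/
@[simp] theorem physTwist_apply (θ : Fin 4 → ℂ) (A : PEPSTensor 4 D) (k : Fin 4) (l u r d : Fin D) :
    physTwist θ A k l u r d = θ k * A k l u r d := rfl

/-- The weight of a physically twisted tensor. [folklore] -/
theorem fpepsWeight_physTwist (θ : Fin 4 → ℂ) (A : PEPSTensor 4 D) (k : FermionTorus 2 L → Fin 4)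
    (η ν : FermionTorus 2 L → Fin D) :
    fpepsWeight (physTwist θ A) k η ν = (∏ x, θ (k x)) * fpepsWeight A k η ν := by
  simp only [fpepsWeight, physTwist_apply, Finset.prod_mul_distrib]

/-- **Diagonal one-site operators act through the physical leg**: the product operator
`⊗_x θ` (diagonal in the occupation basis, value `Π_x θ_{k_x}` on `|s⟩`) maps `|Ψ(A)⟩` to
`|Ψ(θ · A)⟩`. [folklore] -/
theorem fermionicPEPS_physTwist (gr : Fin D → ZMod 2) (θ : Fin 4 → ℂ) (A : PEPSTensor 4 D)
    (s : Finset (Orb (FermionTorus 2 L))) :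
    fermionicPEPS L gr (physTwist θ A) s = (∏ x, θ (siteConfig s x)) * fermionicPEPS L gr A s := by
  simp only [fermionicPEPS_apply, fpepsWeight_physTwist, Finset.mul_sum]
  refine Finset.sum_congr rfl fun η _ => Finset.sum_congr rfl fun ν _ => ?_
  ring

/-- **The `U(1)` charge rotation acts through the physical leg**: `z^{N̂} |Ψ(A)⟩ = |Ψ(A_z)⟩` with
`(A_z)^k = z^{|k|_N} A^k` (`z = e^{iθ}`: `e^{iθN̂}`; `N̂ = totalNumberOp` is `diagonal (#s)` by
`totalNumberOp_eq_diagonal`). [folklore] -/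
theorem chargeTwist_mulVec_fermionicPEPS [DecidableEq (Orb (FermionTorus 2 L))]
    (gr : Fin D → ZMod 2) (A : PEPSTensor 4 D) (z : ℂ) :
    diagonal (fun s => z ^ s.card) *ᵥ fermionicPEPS L gr A =
      fermionicPEPS L gr (physTwist (fun k => z ^ siteCharge k) A) := by
  funext s
  rw [mulVec_diagonal, fermionicPEPS_physTwist, card_eq_sum_siteCharge, Finset.prod_pow_eq_pow_sum]

/-- A diagonal gauge transformation of the virtual legs: `g` on the left kets, `h` on the up kets,
`g'` on the right bras, `h'` on the down bras,
`(A')^k_{l u r d} = g_l h_u g'_r h'_d A^k_{l u r d}`. [cite: SchuchCiracPerezGarcia2010, Def. 5.1] -/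
def legGauge (g g' h h' : Fin D → ℂ) (A : PEPSTensor 4 D) : PEPSTensor 4 D :=
  fun k l u r d => g l * h u * g' r * h' d * A k l u r d

/-- `legGauge` entrywise. [folklore] -/
@[simp] theorem legGauge_apply (g g' h h' : Fin D → ℂ) (A : PEPSTensor 4 D) (k : Fin 4)
    (l u r d : Fin D) : legGauge g g' h h' A k l u r d = g l * h u * g' r * h' d * A k l u r d := rfl

/-- Inverse diagonal gauges on the two ends of every bond cancel in the weight.
[cite: SchuchCiracPerezGarcia2010, Def. 5.1] -/
theorem fpepsWeight_legGauge {g g' h h' : Fin D → ℂ} (hg : ∀ a, g a * g' a = 1)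
    (hh : ∀ a, h a * h' a = 1) (A : PEPSTensor 4 D) (k : FermionTorus 2 L → Fin 4)
    (η ν : FermionTorus 2 L → Fin D) :
    fpepsWeight (legGauge g g' h h' A) k η ν = fpepsWeight A k η ν := by
  simp only [fpepsWeight, legGauge_apply, Finset.prod_mul_distrib]
  have h0 : ∏ x, g (η (backStep 0 x)) = ∏ x, g (η x) :=
    Fintype.prod_equiv (backStep 0) _ _ fun _ => rfl
  have h1 : ∏ x, h (ν (backStep 1 x)) = ∏ x, h (ν x) :=
    Fintype.prod_equiv (backStep 1) _ _ fun _ => rfl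
  have hg' : (∏ x, g (η x)) * ∏ x, g' (η x) = 1 := by
    rw [← Finset.prod_mul_distrib]; exact Finset.prod_eq_one fun x _ => hg _
  have hh' : (∏ x, h (ν x)) * ∏ x, h' (ν x) = 1 := by
    rw [← Finset.prod_mul_distrib]; exact Finset.prod_eq_one fun x _ => hh _
  rw [h0, h1]
  calc (∏ x, g (η x)) * (∏ x, h (ν x)) * (∏ x, g' (η x)) * (∏ x, h' (ν x)) *
        ∏ x, A (k x) (η (backStep 0 x)) (ν (backStep 1 x)) (η x) (ν x)
      = ((∏ x, g (η x)) * ∏ x, g' (η x)) * ((∏ x, h (ν x)) * ∏ x, h' (ν x)) *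
        ∏ x, A (k x) (η (backStep 0 x)) (ν (backStep 1 x)) (η x) (ν x) := by ring
    _ = _ := by rw [hg', hh', one_mul, one_mul]

/-- **Virtual gauge invariance** (diagonal gauges): `|Ψ(A')⟩ = |Ψ(A)⟩` for
`(A')^k_{lurd} = g_l h_u g'_r h'_d A^k_{lurd}` with `g g' = 1 = h h'` pointwise — the inserted
`g` and `g' = g⁻¹` meet on every bond; the signs only see the (unchanged) indices.
[cite: SchuchCiracPerezGarcia2010, Def. 5.1] -/
theorem fermionicPEPS_legGauge (gr : Fin D → ZMod 2) {g g' h h' : Fin D → ℂ}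
    (hg : ∀ a, g a * g' a = 1) (hh : ∀ a, h a * h' a = 1) (A : PEPSTensor 4 D) :
    fermionicPEPS L gr (legGauge g g' h h' A) = fermionicPEPS L gr A := by
  funext s
  simp only [fermionicPEPS_apply, fpepsWeight_legGauge hg hh]

/-- **`U(1)`-covariance lemma.** If the charge rotation by `z` on the physical leg is implemented
on the virtual legs by a diagonal gauge (a diagonal virtual representation and its inverse on the
bra legs) up to the factor `w` per site, `z^{|k|_N} A^k_{lurd} = w · g_l h_u g'_r h'_d A^k_{lurd}`,
then `z^{N̂} |Ψ(A)⟩ = w^{L²} |Ψ(A)⟩`: the symmetry "acts through the virtual legs" and cancels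
on the bonds. [cite: SchuchCiracPerezGarcia2010, Def. 5.1] -/
theorem chargeTwist_mulVec_fermionicPEPS_of_covariant [DecidableEq (Orb (FermionTorus 2 L))]
    (gr : Fin D → ZMod 2) (A : PEPSTensor 4 D) (z w : ℂ) {g g' h h' : Fin D → ℂ}
    (hg : ∀ a, g a * g' a = 1) (hh : ∀ a, h a * h' a = 1)
    (hcov : physTwist (fun k => z ^ siteCharge k) A = w • legGauge g g' h h' A) :
    diagonal (fun s => z ^ s.card) *ᵥ fermionicPEPS L gr A =
      w ^ Fintype.card (FermionTorus 2 L) • fermionicPEPS L gr A := by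
  rw [chargeTwist_mulVec_fermionicPEPS, hcov, fermionicPEPS_smul, fermionicPEPS_legGauge gr hg hh]

/-- **Charge quantum number of a covariant fPEPS.** If for every `z ≠ 0` the charge rotation
`z^{|k|_N}` on the physical leg equals a diagonal virtual gauge up to `z^c` per site, then
`|Ψ(A)⟩` has exactly `c · L²` electrons. [cite: SchuchCiracPerezGarcia2010, Def. 5.1] -/
theorem isNParticle_fermionicPEPS_of_covariant (gr : Fin D → ZMod 2) (A : PEPSTensor 4 D) (c : ℕ)
    (hcov : ∀ z : ℂ, z ≠ 0 → ∃ g g' h h' : Fin D → ℂ, (∀ a, g a * g' a = 1) ∧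
      (∀ a, h a * h' a = 1) ∧ physTwist (fun k => z ^ siteCharge k) A = z ^ c • legGauge g g' h h' A) :
    IsNParticle (c * Fintype.card (FermionTorus 2 L)) (fermionicPEPS L gr A) := by
  classical
  intro s hs
  obtain ⟨g, g', h, h', hg, hh, hcov2⟩ := hcov 2 two_ne_zero
  have key := congrFun (chargeTwist_mulVec_fermionicPEPS_of_covariant gr A 2 (2 ^ c) hg hh hcov2) s
  rw [mulVec_diagonal, Pi.smul_apply, smul_eq_mul, ← pow_mul] at key
  have hne : (2 : ℂ) ^ s.card ≠ (2 : ℂ) ^ (c * Fintype.card (FermionTorus 2 L)) := by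
    intro h2
    apply hs
    have h2' : ((2 ^ s.card : ℕ) : ℂ) = ((2 ^ (c * Fintype.card (FermionTorus 2 L)) : ℕ) : ℂ) := by
      exact_mod_cast h2
    exact Nat.pow_right_injective (le_refl 2) (Nat.cast_injective h2')
  have : ((2 : ℂ) ^ s.card - 2 ^ (c * Fintype.card (FermionTorus 2 L))) * fermionicPEPS L gr A s = 0 := by
    rw [sub_mul, key, sub_self]
  exact (mul_eq_zero.mp this).resolve_left (sub_ne_zero.mpr hne)

/-! #### Degenerate bond dimension -/

/-- For `D = 0` there are no bond variables and `|Ψ(A)⟩ = 0` (documented junk value).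
[folklore] -/
theorem fermionicPEPS_eq_zero_of_D_eq_zero (gr : Fin 0 → ZMod 2) (A : PEPSTensor 4 0) :
    fermionicPEPS L gr A = 0 := by
  funext s
  haveI : IsEmpty (FermionTorus 2 L → Fin 0) :=
    ⟨fun η => Fin.elim0 (η (FermionTorus.ofTorusSite 0))⟩
  simp [fermionicPEPS_apply]

end Torus

/-! ### Blocks with open legs: the blocked tensor and the block map `Γ_R` -/

section Block

variable {D : ℕ}

/-- The letters of the graded word of an `n × m` block (`n` columns, `m` rows; block sites
`p = (a, b)`, `a` the column, in the lexicographic order, which is the order induced from the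
torus on a block that does not wrap around): `(p, slot)` as in `FPEPSLeg`. [folklore] -/
abbrev FPEPSBlockLeg (n m : ℕ) : Type := (Fin n ×ₗ Fin m) ×ₗ Fin 5

/-- The TARGET arrangement of the block word: first the internally contracted pairs (bra first),
then the OPEN kets (left legs of column `0` by row, then up legs of row `0` by column), then the
physical kets by site, then the OPEN bras (right legs of the last column by row, then down legs of
the last row by column) — i.e. the blocked tensor is read in the internal order
`|l₀)⋯|l_{m-1}) |u₀)⋯|u_{n-1}) |k⟩ (r₀|⋯(r_{m-1}| (d₀|⋯(d_{n-1}|`, the shape of a one-site tensor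
with fat legs. Bonds are addressed on the `(n+1) × (m+1)` grid: the horizontal bond variable
`(a, b) : Fin (n+1) × Fin m` (`a.castSucc` = left leg of column `a`, `a.succ` = its right leg, as
in `pepsRectWeight`) sits at `(a, b.castSucc)` with ranks `0` (bra) `1` (ket), the vertical one
`(a, b) : Fin n × Fin (m+1)` at `(a.castSucc, b)` with ranks `2`, `3`.
[cite: BultinckWilliamsonHaegemanVerstraete2017fMPS, §IV.A] -/
def blockLegTarget (n m : ℕ) (a : FPEPSBlockLeg n m) :
    Fin 6 ×ₗ ((Fin (n + 1) ×ₗ Fin (m + 1)) ×ₗ Fin 4) :=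
  ![(if ((ofLex (ofLex a).1).1 : ℕ) = 0 then
        toLex ((1 : Fin 6), toLex (toLex ((ofLex (ofLex a).1).1.castSucc, (ofLex (ofLex a).1).2.castSucc),
          (0 : Fin 4)))
      else toLex ((0 : Fin 6), toLex (toLex ((ofLex (ofLex a).1).1.castSucc,
          (ofLex (ofLex a).1).2.castSucc), (1 : Fin 4))) :
        Fin 6 ×ₗ ((Fin (n + 1) ×ₗ Fin (m + 1)) ×ₗ Fin 4)),
    (if ((ofLex (ofLex a).1).2 : ℕ) = 0 then
        toLex ((2 : Fin 6), toLex (toLex ((ofLex (ofLex a).1).1.castSucc, (ofLex (ofLex a).1).2.castSucc),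
          (0 : Fin 4)))
      else toLex ((0 : Fin 6), toLex (toLex ((ofLex (ofLex a).1).1.castSucc,
          (ofLex (ofLex a).1).2.castSucc), (3 : Fin 4)))),
    toLex ((3 : Fin 6), toLex (toLex ((ofLex (ofLex a).1).1.castSucc, (ofLex (ofLex a).1).2.castSucc),
      (0 : Fin 4))),
    (if ((ofLex (ofLex a).1).1 : ℕ) + 1 = n then
        toLex ((4 : Fin 6), toLex (toLex ((ofLex (ofLex a).1).1.succ, (ofLex (ofLex a).1).2.castSucc),
          (0 : Fin 4)))
      else toLex ((0 : Fin 6), toLex (toLex ((ofLex (ofLex a).1).1.succ,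
          (ofLex (ofLex a).1).2.castSucc), (0 : Fin 4)))),
    (if ((ofLex (ofLex a).1).2 : ℕ) + 1 = m then
        toLex ((5 : Fin 6), toLex (toLex ((ofLex (ofLex a).1).1.castSucc, (ofLex (ofLex a).1).2.succ),
          (0 : Fin 4)))
      else toLex ((0 : Fin 6), toLex (toLex ((ofLex (ofLex a).1).1.castSucc,
          (ofLex (ofLex a).1).2.succ), (2 : Fin 4))))] (ofLex a).2

/-- The `ℤ₂`-degrees of the block letters for physical indices `k`, horizontal bond variables
`η : Fin (n+1) × Fin m → Fin D` and vertical ones `ν : Fin n × Fin (m+1) → Fin D` (conventions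
of `pepsRectWeight`). [cite: BultinckWilliamsonHaegemanVerstraete2017fMPS, §IV.A] -/
def blockLegDegree (n m : ℕ) (gr : Fin D → ZMod 2) (k : Fin n × Fin m → Fin 4)
    (η : Fin (n + 1) × Fin m → Fin D) (ν : Fin n × Fin (m + 1) → Fin D) (a : FPEPSBlockLeg n m) :
    ZMod 2 :=
  ![gr (η ((ofLex (ofLex a).1).1.castSucc, (ofLex (ofLex a).1).2)),
    gr (ν ((ofLex (ofLex a).1).1, (ofLex (ofLex a).1).2.castSucc)),
    siteGrade (k (ofLex (ofLex a).1)),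
    gr (η ((ofLex (ofLex a).1).1.succ, (ofLex (ofLex a).1).2)),
    gr (ν ((ofLex (ofLex a).1).1, (ofLex (ofLex a).1).2.succ))] (ofLex a).2

/-- The sign of one term of the fermionic contraction of a block with open legs: the Koszul sign
of the reordering from the block word `⊗_p (|l)_p |u)_p |k_p⟩ (r|_p (d|_p)` to `blockLegTarget`.
[cite: BultinckWilliamsonHaegemanVerstraete2017fMPS, §IV.A] -/
def fpepsRectSign (n m : ℕ) (gr : Fin D → ZMod 2) (k : Fin n × Fin m → Fin 4)
    (η : Fin (n + 1) × Fin m → Fin D) (ν : Fin n × Fin (m + 1) → Fin D) : ℂ :=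
  koszulSign (blockLegDegree n m gr k η ν) (fun a : FPEPSBlockLeg n m => a) (blockLegTarget n m)

/-- **The fermionic block map `Γ_R`** of an `n × m` block `R`: the vector of the block Fock space
`Fock (Orb (Fin n ×ₗ Fin m))` obtained by contracting the copies of `A` inside the block
fermionically (signs `fpepsRectSign`, weights `pepsRectWeight`) and pairing the open legs, read in
the internal order of `blockLegTarget`, with the coefficient tensor `X` (left legs, up legs, right
legs, down legs) — the `ℤ₂`-graded version of `pepsRect`; it is linear in `X` (`fpepsRectLin`).
Equivalently `Γ(X) = Σ_c X(c) · B_c`, where `B_c` is the component of the blocked (open) tensor on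
the boundary basis configuration `c = (l, u, r, d)` in that internal order. For an EVEN tensor
`A` the blocked tensor is even, so the physical parity of `B_c` is `boundaryGrade c`, and
contracting instead an honest dual boundary tensor (in any internal order of its own) changes
`X(c)` by a sign depending only on `c` (a diagonal `±1` change of basis of the boundary space,
which preserves `evenBoundary`); hence `fpepsRectRange`, `IsInjectiveFPEPS` and
`IsParityInjectiveFPEPS` below do not depend on that choice for even tensors.
Pérez-García–Verstraete–Wolf–Cirac (2008) §4 (`Γ_R`); Bultinck et al. (2017) §V (injectivity
and its stability under blocking for fMPS). [cite: BultinckWilliamsonHaegemanVerstraete2017fMPS, §V] -/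
def fpepsRect (n m : ℕ) (gr : Fin D → ZMod 2) (A : PEPSTensor 4 D) (X : PEPSBoundary D n m) :
    Fock (Orb (Fin n ×ₗ Fin m)) :=
  fun s => ∑ η : Fin (n + 1) × Fin m → Fin D, ∑ ν : Fin n × Fin (m + 1) → Fin D,
    fpepsRectSign n m gr (fun p => siteConfig s (toLex p)) η ν *
      pepsRectWeight n m A (fun p => siteConfig s (toLex p)) η ν *
        X (fun b => η (0, b)) (fun a => ν (a, 0)) (fun b => η (Fin.last n, b))
          (fun a => ν (a, Fin.last m))

/-- `fpepsRect` unfolded. [folklore] -/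
theorem fpepsRect_apply (n m : ℕ) (gr : Fin D → ZMod 2) (A : PEPSTensor 4 D)
    (X : PEPSBoundary D n m) (s : Finset (Orb (Fin n ×ₗ Fin m))) :
    fpepsRect n m gr A X s = ∑ η : Fin (n + 1) × Fin m → Fin D, ∑ ν : Fin n × Fin (m + 1) → Fin D,
      fpepsRectSign n m gr (fun p => siteConfig s (toLex p)) η ν *
        pepsRectWeight n m A (fun p => siteConfig s (toLex p)) η ν *
          X (fun b => η (0, b)) (fun a => ν (a, 0)) (fun b => η (Fin.last n, b))
            (fun a => ν (a, Fin.last m)) := rfl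

/-- The block map as a `ℂ`-linear map `(boundary tensors) →ₗ (block Fock space)`.
[cite: BultinckWilliamsonHaegemanVerstraete2017fMPS, §V] -/
def fpepsRectLin (n m : ℕ) (gr : Fin D → ZMod 2) (A : PEPSTensor 4 D) :
    PEPSBoundary D n m →ₗ[ℂ] Fock (Orb (Fin n ×ₗ Fin m)) where
  toFun := fpepsRect n m gr A
  map_add' X Y := by
    funext s
    simp only [fpepsRect_apply, Pi.add_apply, mul_add, Finset.sum_add_distrib]
  map_smul' c X := by
    funext s
    simp only [fpepsRect_apply, Pi.smul_apply, smul_eq_mul, RingHom.id_apply, Finset.mul_sum]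
    refine Finset.sum_congr rfl fun η _ => Finset.sum_congr rfl fun ν _ => ?_
    ring

/-- `fpepsRectLin` is `fpepsRect`. [folklore] -/
@[simp] theorem fpepsRectLin_apply (n m : ℕ) (gr : Fin D → ZMod 2) (A : PEPSTensor 4 D)
    (X : PEPSBoundary D n m) : fpepsRectLin n m gr A X = fpepsRect n m gr A X := rfl

/-- The **total boundary degree** `Σ |l_b| + Σ |u_a| + Σ |r_b| + Σ |d_a| ∈ ℤ₂` of a basis boundary
configuration. [cite: BultinckWilliamsonHaegemanVerstraete2017fMPS, §IV.B] -/
def boundaryGrade (n m : ℕ) (gr : Fin D → ZMod 2) (l : Fin m → Fin D) (u : Fin n → Fin D)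
    (r : Fin m → Fin D) (d : Fin n → Fin D) : ZMod 2 :=
  ∑ b, gr (l b) + ∑ a, gr (u a) + ∑ b, gr (r b) + ∑ a, gr (d a)

/-- The **even boundary subspace**: boundary tensors supported on configurations of even total
degree (the fixed space of the fermion-parity action `P^{⊗(2m+2n)}` on the open legs).
[cite: BultinckWilliamsonHaegemanVerstraete2017fMPS, §IV.B] -/
def evenBoundary (n m : ℕ) (gr : Fin D → ZMod 2) : Submodule ℂ (PEPSBoundary D n m) where
  carrier := {X | ∀ l u r d, boundaryGrade n m gr l u r d ≠ 0 → X l u r d = 0}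
  add_mem' {X Y} hX hY l u r d h := by simp [Pi.add_apply, hX l u r d h, hY l u r d h]
  zero_mem' _ _ _ _ _ := rfl
  smul_mem' c X hX l u r d h := by simp [hX l u r d h]

/-- Membership in the even boundary subspace. [folklore] -/
@[simp] theorem mem_evenBoundary_iff (n m : ℕ) (gr : Fin D → ZMod 2) (X : PEPSBoundary D n m) :
    X ∈ evenBoundary n m gr ↔ ∀ l u r d, boundaryGrade n m gr l u r d ≠ 0 → X l u r d = 0 :=
  Iff.rfl

/-- The **local fermionic PEPS space** `𝒮_{n×m}` of the block: the range of the block map (the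
span of the block states with arbitrary boundary tensor), a subspace of the block Fock space.
[cite: PerezGarciaVerstraeteWolfCirac2008PEPS, §4] -/
def fpepsRectRange (n m : ℕ) (gr : Fin D → ZMod 2) (A : PEPSTensor 4 D) :
    Submodule ℂ (Fock (Orb (Fin n ×ₗ Fin m))) :=
  LinearMap.range (fpepsRectLin n m gr A)

/-- **Injectivity** of the `n × m` block of the fermionic PEPS: the block map is injective on
all boundary tensors. [cite: PerezGarciaVerstraeteWolfCirac2008PEPS, §4] -/
def IsInjectiveFPEPS (n m : ℕ) (gr : Fin D → ZMod 2) (A : PEPSTensor 4 D) : Prop :=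
  Function.Injective (fpepsRect n m gr A)

/-- **Parity-graded injectivity** (`G`-injectivity for `G = ℤ₂` fermion parity acting by the
parity matrix on the virtual legs): the block map is injective on the EVEN boundary subspace.
[cite: SchuchCiracPerezGarcia2010, Def. 5.1] -/
def IsParityInjectiveFPEPS (n m : ℕ) (gr : Fin D → ZMod 2) (A : PEPSTensor 4 D) : Prop :=
  ∀ X ∈ evenBoundary n m gr, fpepsRect n m gr A X = 0 → X = 0

/-- Injective blocks are parity-injective. [folklore] -/
theorem IsInjectiveFPEPS.isParityInjective {n m : ℕ} {gr : Fin D → ZMod 2} {A : PEPSTensor 4 D}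
    (h : IsInjectiveFPEPS n m gr A) : IsParityInjectiveFPEPS n m gr A := by
  intro X _ hX
  apply h
  rw [hX]
  exact ((fpepsRectLin n m gr A).map_zero).symm

/-- For a `1 × 1` block no letter moves: the fermionic block map is the bosonic one, `Γ = pepsRect`,
read through `siteConfig`. [folklore] -/
theorem fpepsRectSign_one_one (gr : Fin D → ZMod 2) (k : Fin 1 × Fin 1 → Fin 4)
    (η : Fin (1 + 1) × Fin 1 → Fin D) (ν : Fin 1 × Fin (1 + 1) → Fin D) :
    fpepsRectSign 1 1 gr k η ν = 1 := by
  refine koszulSign_of_strictMono fun i j hij => ?_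
  revert i j
  decide

/-- The `1 × 1` fermionic block map is the bosonic single-site map. [folklore] -/
theorem fpepsRect_one_one (gr : Fin D → ZMod 2) (A : PEPSTensor 4 D) (X : PEPSBoundary D 1 1)
    (s : Finset (Orb (Fin 1 ×ₗ Fin 1))) :
    fpepsRect 1 1 gr A X s = pepsRect 1 1 A X (fun p => siteConfig s (toLex p)) := by
  simp only [fpepsRect_apply, pepsRect, fpepsRectSign_one_one, one_mul]

end Block

end Literature.MathematicalPhysics.QuantumLattice
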